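import Mathlib
import Summits.ValiantsHypothesis.ValiantsHypothesis.Theorems.TriangularDimersDivisionEasy.Negative.Basic

/-!
# `TriangularDimersDivisionEasy` — negative-side toolkit 4: rectangles in the doubled encoding

Crux `stmt-ValiantsHypothesis-5067` (`Theses.DivisionGap.TriangularDimersDivisionEasy`, route
DivisionGap).  Standing disprover (cdisprove gen 1); the "rectangle structure" step (V2) of the
load-bearing lemma `false_without_division` (Valiant 1980, Thm 1, for the rhombus).

A product term of the structure theorem is a pair `a`, `b` of monotone polynomials, `a` ordered with row
set `A` (rows = vertices), `b` with `Aᶜ`, and `a * b ≤ D_n` coefficientwise.  Its support consists of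
exponents of dimer covers (`rect f` := the set of these covers, `card_support_mul_eq`), and — the
point of this file — although the DOUBLED edge variables allow a cover in the rectangle to match a
vertex `x ∈ A` with a vertex `y ∉ A` (`x_(x,y)` from `a`, `x_(y,x)` from `b`), this happens UNIFORMLY:
`rect_uniform` — if one cover of the rectangle matches `x ∈ A` with `y ∉ A` then all of them do
(swap argument: over `ℝ≥0`, `supp (a * b) = supp a + supp b`).
[folklore]
-/

namespace Summit.ValiantsHypothesis.ValiantsHypothesis.Theorems.TriangularDimersDivisionEasy.Negative

open Literature.Computability.AlgebraicComplexity
open MvPolynomial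
open scoped BigOperators NNReal Pointwise

set_option linter.dupNamespace false

noncomputable section

open Classical

variable {n : ℕ}

/-- An entry of a monomial is bounded by its row degree. [folklore] -/
theorem apply_le_rowDegrees {ι κ : Type*} (m : ι × κ →₀ ℕ) (i : ι) (j : κ) :
    m (i, j) ≤ rowDegrees m i := by
  classical
  unfold rowDegrees
  rw [Finsupp.mapDomain, Finsupp.sum_apply]
  simp only [Finsupp.sum]
  by_cases h : (i, j) ∈ m.support
  · calc m (i, j) = Finsupp.single ((i, j) : ι × κ).1 (m (i, j)) i := by simp
      _ ≤ ∑ p ∈ m.support, Finsupp.single p.1 (m p) i :=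
        Finset.single_le_sum (f := fun p => Finsupp.single p.1 (m p) i) (fun _ _ => Nat.zero_le _) h
  · rw [Finsupp.notMem_support_iff.1 h]; exact Nat.zero_le _

/-- A monomial with row degree `0` in row `i` involves no variable of row `i`. [folklore] -/
theorem apply_eq_zero_of_rowDegrees {ι κ : Type*} {m : ι × κ →₀ ℕ} {i : ι} (h : rowDegrees m i = 0)
    (j : κ) : m (i, j) = 0 := by
  have := apply_le_rowDegrees m i j
  rw [h] at this
  exact Nat.le_zero.1 this

section Rect

variable (A : Finset (Vtx n)) (a b : MvPolynomial (Var n) ℝ≥0)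

/-- The dimer covers whose exponent lies in the support of the product term. [folklore] -/
def rect : Finset (Vtx n → Vtx n) := (dimers n).filter fun f => dimerExp f ∈ (a * b).support

variable {A a b}

/-- Membership in the rectangle of covers. [folklore] -/
theorem mem_rect {f : Vtx n → Vtx n} : f ∈ rect a b ↔ f ∈ dimers n ∧ dimerExp f ∈ (a * b).support := by
  simp [rect]

/-- Domination puts the support of the product inside the support of `D_n`. [folklore] -/
theorem support_mul_subset (hdom : ∀ m, coeff m (a * b) ≤ coeff m (triPM n)) :
    (a * b).support ⊆ (triPM n).support := by
  intro m hm
  rw [mem_support_iff] at hm ⊢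
  intro h0
  have := hdom m
  rw [h0] at this
  exact hm (nonpos_iff_eq_zero.1 this)

/-- The support of the product term is in bijection with its rectangle of covers. [folklore] -/
theorem card_support_mul_eq (hdom : ∀ m, coeff m (a * b) ≤ coeff m (triPM n)) :
    (a * b).support.card = (rect a b).card := by
  have : (a * b).support = (rect a b).image dimerExp := by
    ext m
    constructor
    · intro hm
      obtain ⟨f, hf, rfl⟩ := (mem_support_triPM m).1 (support_mul_subset hdom hm)
      exact Finset.mem_image.2 ⟨f, mem_rect.2 ⟨hf, hm⟩, rfl⟩
    · intro hm
      obtain ⟨f, hf, rfl⟩ := Finset.mem_image.1 hm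
      exact (mem_rect.1 hf).2
  rw [this, Finset.card_image_of_injective _ dimerExp_injective]

/-- The rectangle consists of dimer covers. [folklore] -/
theorem rect_subset_dimers : rect a b ⊆ dimers n := Finset.filter_subset _ _

/-- **Uniform status of mixed pairs.**  If `a` is ordered with row set `A`, `b` with `Aᶜ`, and
`a * b ≤ D_n` coefficientwise, then for `x ∈ A`, `y ∉ A`: if ONE cover of the rectangle matches `x`
with `y`, ALL covers of the rectangle do. [folklore] -/
theorem rect_uniform (ha : IsOrdered A a) (hb : IsOrdered Aᶜ b)
    (hdom : ∀ m, coeff m (a * b) ≤ coeff m (triPM n)) {x y : Vtx n} (hx : x ∈ A) (hy : y ∉ A)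
    {f₁ f₂ : Vtx n → Vtx n} (h₁ : f₁ ∈ rect a b) (h₂ : f₂ ∈ rect a b) (hxy : f₁ x = y) :
    f₂ x = y := by
  obtain ⟨hf₁, hs₁⟩ := mem_rect.1 h₁
  obtain ⟨hf₂, hs₂⟩ := mem_rect.1 h₂
  have hd₁ : IsDimer f₁ := (Finset.mem_filter.1 hf₁).2
  have hd₂ : IsDimer f₂ := (Finset.mem_filter.1 hf₂).2
  -- decompose the two exponents
  obtain ⟨m₁, hm₁, m₁', hm₁', he₁⟩ := Finset.mem_add.1 (support_mul a b hs₁)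
  obtain ⟨m₂, hm₂, m₂', hm₂', he₂⟩ := Finset.mem_add.1 (support_mul a b hs₂)
  -- the mixed exponent `m₂ + m₁'` is again a dimer cover `g`
  have hmix : m₂ + m₁' ∈ (a * b).support := add_mem_support_mul hm₂ hm₁'
  obtain ⟨g, hg, hge⟩ := (mem_support_triPM _).1 (support_mul_subset hdom hmix)
  have hdg : IsDimer g := (Finset.mem_filter.1 hg).2
  -- row-degree vanishing
  have hy' : y ∈ Aᶜ := Finset.mem_compl.2 hy
  have r₁ : rowDegrees m₁ y = 0 := by rw [ha m₁ hm₁ y, if_neg hy]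
  have r₂ : rowDegrees m₂ y = 0 := by rw [ha m₂ hm₂ y, if_neg hy]
  have r₁' : rowDegrees m₁' x = 0 := by
    rw [hb m₁' hm₁' x, if_neg (by rw [Finset.mem_compl]; exact fun h => h hx)]
  have r₂' : rowDegrees m₂' x = 0 := by
    rw [hb m₂' hm₂' x, if_neg (by rw [Finset.mem_compl]; exact fun h => h hx)]
  -- (1) `m₁' (y, x) = 1` because `f₁ y = x`
  have hf₁yx : f₁ y = x := by rw [← hxy, (hd₁ x).1]
  have e1 : (m₁ + m₁') (y, x) = 1 := by
    rw [he₁, dimerExp_apply, if_pos hf₁yx]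
  have hm₁'yx : m₁' (y, x) = 1 := by
    have := e1; rw [Finsupp.add_apply, apply_eq_zero_of_rowDegrees r₁ x, zero_add] at this; exact this
  -- (2) hence `g y = x`, so `g x = y`
  have hgyx : g y = x := by
    have := congrArg (fun e => e (y, x)) hge
    simp only [Finsupp.add_apply, apply_eq_zero_of_rowDegrees r₂ x, zero_add, hm₁'yx,
      dimerExp_apply] at this
    by_contra hne
    rw [if_neg hne] at this
    exact one_ne_zero this.symm
  have hgxy : g x = y := by rw [← hgyx, (hdg y).1]
  -- (3) `m₂ (x, y) = 1`
  have hm₂xy : m₂ (x, y) = 1 := by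
    have := congrArg (fun e => e (x, y)) hge
    simp only [Finsupp.add_apply, apply_eq_zero_of_rowDegrees r₁' y, add_zero, dimerExp_apply,
      if_pos hgxy] at this
    exact this.symm
  -- (4) hence `f₂ x = y`
  have := congrArg (fun e => e (x, y)) he₂
  simp only [Finsupp.add_apply, hm₂xy, apply_eq_zero_of_rowDegrees r₂' y, add_zero,
    dimerExp_apply] at this
  by_contra hne
  rw [if_neg hne] at this
  exact one_ne_zero this

/-- The same with the roles of `x` and `y` read through the involution: a cover in the rectangle
matches `x` with `y` iff it matches `y` with `x`; so uniformity also holds for `x ∉ A`, `y ∈ A`.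
[folklore] -/
theorem rect_uniform' (ha : IsOrdered A a) (hb : IsOrdered Aᶜ b)
    (hdom : ∀ m, coeff m (a * b) ≤ coeff m (triPM n)) {x y : Vtx n} (hx : x ∉ A) (hy : y ∈ A)
    {f₁ f₂ : Vtx n → Vtx n} (h₁ : f₁ ∈ rect a b) (h₂ : f₂ ∈ rect a b) (hxy : f₁ x = y) :
    f₂ x = y := by
  have hd₁ : IsDimer f₁ := (Finset.mem_filter.1 (mem_rect.1 h₁).1).2
  have hd₂ : IsDimer f₂ := (Finset.mem_filter.1 (mem_rect.1 h₂).1).2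
  have h1 : f₁ y = x := by rw [← hxy, (hd₁ x).1]
  have h2 : f₂ y = x := rect_uniform ha hb hdom hy hx h₁ h₂ h1
  rw [← h2, (hd₂ y).1]

end Rect

end

end Summit.ValiantsHypothesis.ValiantsHypothesis.Theorems.TriangularDimersDivisionEasy.Negative
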